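import Summits.NavierStokesRegularity.FunctionalMining.StretchingLaminateBetchov
import Summits.NavierStokesRegularity.FunctionalMining.StretchingLaminateConst
import Summits.NavierStokesRegularity.FunctionalMining.StretchingLaminateQuarticCert
import Mathlib.Tactic.LinearCombination
import Mathlib.Tactic.Linarith
import Mathlib.Tactic.Positivity
import HarnessLib

/-!
# FunctionalMining — K1-Q1 laminates: the QUARTIC SUPERSOLUTION (T4) and the dual assembly of THEOREM L-CAP — `LeafClaim θ a b c → RatioBound θ` (dict seat, staged)

search for candidate a priori estimates; no regularity claim.  Static, finite tree algebra (ℚ) plus one real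
assembly; nothing about Navier–Stokes solutions; no literature claim.  Everything is [ours; elementary]
except the typed node `LeafClaim` (a `Prop`, NOT asserted).

Source (paper level, ours): bank g5 `pub-nsfunc-bank/K1Q1-LAMINATE-CAP.md` §2–3 (THEOREM L-CAP, hand
variant T4: `C_lam ≤ 269427/250000 = 1.077708`; headline v2 with a sextic supersolution: `1.021188`), the
polynomial step countersigned exactly by census-1 A (`exact/lamcap-A/LAMCAP-A.md`, 0 contested).

* **(T4) quartic supersolution, KERNEL.** `Grad.quarticU M₂ G = |S|⁴ + (6|S|² + 24M₂)(M₂ − |ω|²)`.  The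
  per-node two-point inequality `λU(G₊) + (1−λ)U(G₋) ≤ U(G)` for a div-free split with `|ω(G±)|² ≤ M₂`,
  `0 ≤ λ ≤ 1` (`Grad.quarticU_split`) is proved from an EXACT ALGEBRAIC CERTIFICATE in symmetric coordinates
  (`quartic_two_point`, `cert_identity`, `certSOS`, `certLIN`, `certMU` of the companion file `StretchingLaminateQuarticCert` (ao)):
  `U(G) − λU₊ − (1−λ)U₋ = λ(1−λ)·(certSOS + certLIN) + certMU·(|T|² − ½|w|²)`, where `certSOS` is a sum of
  squares (the Lagrange minors of `|S|²|T|² − (S:T)²`, `|ω × w|²`, and the Taylor-kernel square of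
  `S:T + 2ω·w`), `certLIN = 42|w|²[(1+λ)/6·(M₂ − m₊) + (2−λ)/6·(M₂ − m₋) + (1+λ(1−λ))/12·|w|²] ≥ 0`, and
  `|T|² − ½|w|² = (c·n)²` vanishes on div-free splits (bank's concavity bracket `42(m−1) ≤ 0`, integrated
  against the Taylor kernel; identity found and verified symbolically, then re-verified here by `ring`).
  Tree induction: `Tree.leafSum_quarticU_le`, at the root **`Tree.quartic_moment :
  Σ_L W_L U_{M₂}(G_L) ≤ 24 M₂²`** whenever `M²(𝒯) ≤ M₂` — in particular `Σ_L W_L |S_L|⁴ ≤ 24 M⁴`.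
* **Dual assembly.** `LeafClaim θ a b c` is the typed POINTWISE node (bank §3 with §1's eigenvalue facts
  `p ≤ |ω|² s₁`, `tr S³ = (3/2)s₁(2s₁² − q)`, `√(q/6) ≤ s₁ ≤ √(2q/3)` folded in; homogeneous form):
  `(1 − ¾b)·ωᵀSω ≤ θ M |S|² + a M (|S|² − ½|ω|²) + b tr S³ + (c/M)(U_{M²}(G) − 24M⁴)` at every trace-free
  rational state with `|ω|² ≤ M²`, `M > 0`.  **`ratioBound_of_leafClaim : LeafClaim θ a b c → 0 ≤ c →
  RatioBound θ`** (sum the claim over the leaves with weights — `Tree.leafClaim_sum` — and use (I1)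
  `energy_eq_leafSum_sSq` / `leafSum_sSq_sub_half_vortSq`, (I2) `betchov`, (T4) `quartic_moment`,
  `leafSum_one`).  With bank's T4 multipliers (`lcapA`, `lcapB`, `lcapC`, `lcapTheta = 269427/250000`):
  **`laminateSupConst_le_of_lcapClaim : LCapLeafClaim → laminateSupConst ≤ 269427/250000`** and
  **`laminateDeficit_of_lcapClaim : LCapLeafClaim → LaminateDeficit`** — the realization-free
  `LaminateDeficit` of (ae), conditional only on the 2-variable polynomial claim (paper + two exact
  certificates; not kernel).  The sextic (T6) variant `1.021188` needs a sextic supersolution file; not here.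
search for candidate a priori estimates; no regularity claim.
-/


namespace Summit.NavierStokesRegularity.FunctionalMining

open Literature.Analysis Literature.Analysis.FunctionSpaces Literature.Analysis.FunctionSpaces.Torus
open Literature.Analysis.FluidPDE Literature.Analysis.FluidPDE.Torus

namespace Laminate


/-! ## (T4) on the tree -/

namespace Grad

/-- **The quartic supersolution** `U_{M₂}(G) = |S|⁴ + (6|S|² + 24M₂)(M₂ − |ω|²)`. [ours; bookkeeping] -/
def quarticU (M2 : ℚ) (G : Grad) : ℚ := G.sSq ^ 2 + (6 * G.sSq + 24 * M2) * (M2 - G.vortSq)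

/-- `U_{M₂}(0) = 24 M₂²`. [ours; bookkeeping] -/
theorem quarticU_zero (M2 : ℚ) : Grad.zero.quarticU M2 = 24 * M2 ^ 2 := by
  simp [quarticU, zero, sSq, vortSq, vort0, vort1, vort2]; ring

/-- **Per-node two-point inequality for `U`** on a div-free split with both children in `{|ω|² ≤ M₂}`:
`λ U(G₊) + (1−λ) U(G₋) ≤ U(G)`. [ours; elementary] -/
theorem quarticU_split (G : Grad) (s : Split) (hdot : s.dot = 0) (h0 : 0 ≤ s.lam) (h1 : s.lam ≤ 1)
    {M2 : ℚ} (hp : (G.layer (1 - s.lam) s).vortSq ≤ M2) (hm : (G.layer (-s.lam) s).vortSq ≤ M2) :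
    s.lam * (G.layer (1 - s.lam) s).quarticU M2 + (1 - s.lam) * (G.layer (-s.lam) s).quarticU M2
      ≤ G.quarticU M2 := by
  have hdot' : s.c0 * s.n0 + s.c1 * s.n1 + s.c2 * s.n2 = 0 := by simpa [Split.dot] using hdot
  have hT : symSq (s.c0 * s.n0) (s.c1 * s.n1) (s.c2 * s.n2) ((s.c0 * s.n1 + s.c1 * s.n0) / 2)
      ((s.c0 * s.n2 + s.c2 * s.n0) / 2) ((s.c1 * s.n2 + s.c2 * s.n1) / 2) - vSq s.w0 s.w1 s.w2 / 2 = 0 := by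
    simp only [symSq, vSq, Split.w0, Split.w1, Split.w2]
    linear_combination (s.c0 * s.n0 + s.c1 * s.n1 + s.c2 * s.n2) * hdot'
  have hp' : vSq (G.vort0 + (1 - s.lam) * s.w0) (G.vort1 + (1 - s.lam) * s.w1) (G.vort2 + (1 - s.lam) * s.w2) ≤ M2 := by
    have e : (G.layer (1 - s.lam) s).vortSq
        = vSq (G.vort0 + (1 - s.lam) * s.w0) (G.vort1 + (1 - s.lam) * s.w1) (G.vort2 + (1 - s.lam) * s.w2) := by
      simp only [vortSq, vort0_layer, vort1_layer, vort2_layer, vSq]; ring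
    exact e ▸ hp
  have hm' : vSq (G.vort0 - s.lam * s.w0) (G.vort1 - s.lam * s.w1) (G.vort2 - s.lam * s.w2) ≤ M2 := by
    have e : (G.layer (-s.lam) s).vortSq
        = vSq (G.vort0 - s.lam * s.w0) (G.vort1 - s.lam * s.w1) (G.vort2 - s.lam * s.w2) := by
      simp only [vortSq, vort0_layer, vort1_layer, vort2_layer, vSq]; ring
    exact e ▸ hm
  have key := quartic_two_point G.g00 G.g11 G.g22 ((G.g01 + G.g10) / 2) ((G.g02 + G.g20) / 2)
    ((G.g12 + G.g21) / 2) G.vort0 G.vort1 G.vort2 (s.c0 * s.n0) (s.c1 * s.n1) (s.c2 * s.n2)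
    ((s.c0 * s.n1 + s.c1 * s.n0) / 2) ((s.c0 * s.n2 + s.c2 * s.n0) / 2) ((s.c1 * s.n2 + s.c2 * s.n1) / 2)
    s.w0 s.w1 s.w2 s.lam M2 hT h0 h1 hp' hm'
  have e0 : G.quarticU M2 = Uq M2 (symSq G.g00 G.g11 G.g22 ((G.g01 + G.g10) / 2) ((G.g02 + G.g20) / 2)
      ((G.g12 + G.g21) / 2)) (vSq G.vort0 G.vort1 G.vort2) := by
    simp only [quarticU, Uq, symSq, vSq, sSq, vortSq]; ring
  have eP : (G.layer (1 - s.lam) s).quarticU M2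
      = Uq M2 (symSq (G.g00 + (1 - s.lam) * (s.c0 * s.n0)) (G.g11 + (1 - s.lam) * (s.c1 * s.n1))
          (G.g22 + (1 - s.lam) * (s.c2 * s.n2)) ((G.g01 + G.g10) / 2 + (1 - s.lam) * ((s.c0 * s.n1 + s.c1 * s.n0) / 2))
          ((G.g02 + G.g20) / 2 + (1 - s.lam) * ((s.c0 * s.n2 + s.c2 * s.n0) / 2))
          ((G.g12 + G.g21) / 2 + (1 - s.lam) * ((s.c1 * s.n2 + s.c2 * s.n1) / 2)))
        (vSq (G.vort0 + (1 - s.lam) * s.w0) (G.vort1 + (1 - s.lam) * s.w1) (G.vort2 + (1 - s.lam) * s.w2)) := by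
    simp only [quarticU, Uq, symSq, vSq, sSq, vortSq, vort0, vort1, vort2, layer, Split.w0, Split.w1, Split.w2]; ring
  have eM : (G.layer (-s.lam) s).quarticU M2
      = Uq M2 (symSq (G.g00 - s.lam * (s.c0 * s.n0)) (G.g11 - s.lam * (s.c1 * s.n1))
          (G.g22 - s.lam * (s.c2 * s.n2)) ((G.g01 + G.g10) / 2 - s.lam * ((s.c0 * s.n1 + s.c1 * s.n0) / 2))
          ((G.g02 + G.g20) / 2 - s.lam * ((s.c0 * s.n2 + s.c2 * s.n0) / 2))
          ((G.g12 + G.g21) / 2 - s.lam * ((s.c1 * s.n2 + s.c2 * s.n1) / 2)))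
        (vSq (G.vort0 - s.lam * s.w0) (G.vort1 - s.lam * s.w1) (G.vort2 - s.lam * s.w2)) := by
    simp only [quarticU, Uq, symSq, vSq, sSq, vortSq, vort0, vort1, vort2, layer, Split.w0, Split.w1, Split.w2]; ring
  rw [e0, eP, eM]; exact key

end Grad

namespace Tree

/-- **(T4) along the tree (Jensen for the Λ-concave supersolution).** Below a node in state `G` with weight
`W ≥ 0` on a valid tree whose leaves obey `|ω_L|² ≤ M₂`: `Σ_L W_L U_{M₂}(G_L) ≤ W·U_{M₂}(G)`.
[ours; elementary] -/
theorem leafSum_quarticU_le (M2 : ℚ) (T : Tree) (hT : T.valid = true) :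
    ∀ (G : Grad) (W : ℚ), 0 ≤ W → T.vortSupFrom G ≤ M2 →
      T.leafSum (Grad.quarticU M2) G W ≤ W * G.quarticU M2 := by
  induction T with
  | leaf => intro G W _ _; simp [leafSum]
  | node s p m ihp ihm =>
      intro G W hW hsup
      obtain ⟨h0, h1, hdot, hp, hm⟩ := valid_node hT
      have hc := vortSupFrom_children s p m G
      have hsupP := hc.1.trans hsup
      have hsupM := hc.2.trans hsup
      have hvp : (G.layer (1 - s.lam) s).vortSq ≤ M2 := (vortSq_le_vortSupFrom p hp _).trans hsupP
      have hvm : (G.layer (-s.lam) s).vortSq ≤ M2 := (vortSq_le_vortSupFrom m hm _).trans hsupM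
      have hP := ihp hp (G.layer (1 - s.lam) s) (W * s.lam) (mul_nonneg hW h0.le) hsupP
      have hM := ihm hm (G.layer (-s.lam) s) (W * (1 - s.lam)) (mul_nonneg hW (by linarith)) hsupM
      have hnode := mul_le_mul_of_nonneg_left (Grad.quarticU_split G s hdot h0.le h1.le hvp hvm) hW
      simp only [leafSum]
      nlinarith [hP, hM, hnode]

/-- **(T4) THE QUARTIC MOMENT BOUND**: `Σ_L W_L [ |S_L|⁴ + (6|S_L|² + 24M₂)(M₂ − |ω_L|²) ] ≤ 24 M₂²` for every
valid lamination tree with `M²(𝒯) ≤ M₂`; in particular `Σ_L W_L |S_L|⁴ ≤ 24 M⁴` (THEOREM L-CAP §2).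
[ours; elementary] -/
theorem quartic_moment (T : Tree) (hT : T.valid = true) {M2 : ℚ} (hsup : T.vortSup ≤ M2) :
    T.leafSum (Grad.quarticU M2) Grad.zero 1 ≤ 24 * M2 ^ 2 := by
  have h := leafSum_quarticU_le M2 T hT Grad.zero 1 zero_le_one hsup
  rw [Grad.quarticU_zero] at h; linarith

/-- `board`: `Σ W U₁(G_L) = 10 ≤ 24` (with `M₂ = M²(board) = 1`). [ours; bookkeeping] -/
theorem board_quartic : board.leafSum (Grad.quarticU 1) Grad.zero 1 ≤ 24 := by decide +kernel

end Tree

/-! ## The dual assembly: `LeafClaim θ a b c → RatioBound θ` -/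

/-- **Typed node (NOT asserted): the pointwise LEAF INEQUALITY of the dual certificate**, homogeneous form.
For every trace-free rational state `G` and real `M > 0` with `|ω(G)|² ≤ M²`:
`(1 − ¾b)·ωᵀSω ≤ θ·M·|S|² + a·M·(|S|² − ½|ω|²) + b·tr S³ + (c/M)·(U_{M²}(G) − 24M⁴)`.
At paper level it follows from bank's 2-variable claim `Φ(m,q,s) ≤ 0` (K1Q1-LAMINATE-CAP §3; exact
certificates: bank `certify_cap.py` 104 376 boxes, census-1 A 228 boxes + discriminant, 0 contested) via
`p ≤ |ω|² s₁`, `tr S³ = (3/2)s₁(2s₁² − |S|²)`, `√(|S|²/6) ≤ s₁ ≤ √(2|S|²/3)` for the top eigenvalue `s₁`.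
[ours; typed node] -/
def LeafClaim (θ a b c : ℝ) : Prop :=
  ∀ (G : Grad) (M : ℝ), 0 < M → G.trace = 0 → (G.vortSq : ℝ) ≤ M ^ 2 →
    (1 - 3 / 4 * b) * (G.stretch : ℝ)
      ≤ θ * M * (G.sSq : ℝ) + a * M * ((G.sSq : ℝ) - (G.vortSq : ℝ) / 2) + b * (G.symCubeTrace : ℝ)
        + c / M * ((G.sSq : ℝ) ^ 2 + (6 * (G.sSq : ℝ) + 24 * M ^ 2) * (M ^ 2 - (G.vortSq : ℝ)) - 24 * M ^ 4)

namespace Tree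

/-- **Summing the leaf claim down a valid tree.**  Below a trace-free state `G` with weight `W ≥ 0` on a valid
tree whose leaves obey `|ω_L|² ≤ V = M²`, the weighted sum of `LeafClaim` over the leaves reads
`(1 − ¾b) Σ Wσ_L ≤ θM Σ W|S_L|² + aM Σ W(|S_L|² − ½|ω_L|²) + b Σ W tr S_L³ + (c/M)(Σ W U_V(G_L) − 24M⁴ Σ W)`.
[ours; elementary] -/
theorem leafClaim_sum {θ a b c : ℝ} (h : LeafClaim θ a b c) {M : ℝ} (hM : 0 < M) {V : ℚ}
    (hV : ((V : ℚ) : ℝ) = M ^ 2) (T : Tree) (hT : T.valid = true) :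
    ∀ (G : Grad) (W : ℚ), G.trace = 0 → 0 ≤ W → T.vortSupFrom G ≤ V →
      (1 - 3 / 4 * b) * (T.leafSum Grad.stretch G W : ℝ)
        ≤ θ * M * (T.leafSum Grad.sSq G W : ℝ)
          + a * M * ((T.leafSum Grad.sSq G W : ℝ) - (T.leafSum Grad.vortSq G W : ℝ) / 2)
          + b * (T.leafSum Grad.symCubeTrace G W : ℝ)
          + c / M * ((T.leafSum (Grad.quarticU V) G W : ℝ) - 24 * M ^ 4 * (T.leafSum (fun _ => 1) G W : ℝ)) := by
  induction T with
  | leaf =>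
      intro G W htr hW hsup
      have hv : (G.vortSq : ℝ) ≤ M ^ 2 := by
        rw [← hV]; exact_mod_cast (show G.vortSq ≤ V by simpa [vortSupFrom] using hsup)
      have hl := mul_le_mul_of_nonneg_left (h G M hM htr hv) (show (0 : ℝ) ≤ (W : ℝ) by exact_mod_cast hW)
      simp only [leafSum, Grad.quarticU]
      push_cast
      rw [hV]
      linarith
  | node s p m ihp ihm =>
      intro G W htr hW hsup
      obtain ⟨h0, h1, hdot, hp, hm⟩ := valid_node hT
      have htrP : (G.layer (1 - s.lam) s).trace = 0 := by rw [Grad.trace_layer, htr, hdot]; ring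
      have htrM : (G.layer (-s.lam) s).trace = 0 := by rw [Grad.trace_layer, htr, hdot]; ring
      have hc := vortSupFrom_children s p m G
      have hP := ihp hp _ (W * s.lam) htrP (mul_nonneg hW h0.le) (hc.1.trans hsup)
      have hM' := ihm hm _ (W * (1 - s.lam)) htrM (mul_nonneg hW (by linarith)) (hc.2.trans hsup)
      simp only [leafSum]
      push_cast
      linarith

end Tree

/-- **THE DUAL ASSEMBLY OF THEOREM L-CAP**: a pointwise leaf certificate with `c ≥ 0` bounds the laminate
ratio: `LeafClaim θ a b c → RatioBound θ`.  Proof: sum the claim over the leaves (`leafClaim_sum` at the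
root, `M = √(M²(𝒯))`); `Σ W|S_L|² = E` and `Σ W(|S_L|² − ½|ω_L|²) = 0` by (I1), `Σ W tr S_L³ = −¾σ` by
(I2) so the `b`-terms cancel, `Σ W U(G_L) ≤ 24M⁴` by (T4) and `Σ W = 1`; the degenerate case `M(𝒯) = 0`
is the Hölder bound of (ad). [ours; elementary] -/
theorem ratioBound_of_leafClaim {θ a b c : ℝ} (h : LeafClaim θ a b c) (hc : 0 ≤ c) : RatioBound θ := by
  intro T hT
  have hV0 : 0 ≤ T.vortSup := Tree.vortSup_nonneg T hT
  by_cases hz : T.vortSup = 0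
  · have hsup : (T.vortSup : ℝ) ≤ (0 : ℝ) ^ 2 := by rw [hz]; simp
    have hh := Tree.abs_sigma_le_holder T hT le_rfl hsup
    have hs : (T.sigma : ℝ) ≤ 0 := by
      have := (abs_le.mp hh).2; simpa using this
    have : Real.sqrt (T.vortSup : ℝ) = 0 := by rw [hz]; simp
    rw [this]; linarith
  · have hVpos : 0 < T.vortSup := lt_of_le_of_ne hV0 (Ne.symm hz)
    set M : ℝ := Real.sqrt (T.vortSup : ℝ) with hMdef
    have hM : 0 < M := Real.sqrt_pos.mpr (by exact_mod_cast hVpos)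
    have hV : ((T.vortSup : ℚ) : ℝ) = M ^ 2 := by
      rw [hMdef, Real.sq_sqrt (by exact_mod_cast hV0)]
    have hsum := Tree.leafClaim_sum h hM hV T hT Grad.zero 1 Grad.trace_zero zero_le_one
      (show T.vortSupFrom Grad.zero ≤ T.vortSup from le_rfl)
    have e1 : T.energy = T.leafSum Grad.sSq Grad.zero 1 := Tree.energy_eq_leafSum_sSq T hT
    have e2 := Tree.leafSum_sSq_sub_half_vortSq T hT Grad.zero 1
    rw [Grad.trSq_zero, mul_zero] at e2
    have e3 := Tree.betchov T hT
    have e4 := Tree.quartic_moment T hT (le_refl T.vortSup)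
    have e5 := Tree.leafSum_one T Grad.zero 1
    have e6 : T.sigma = T.leafSum Grad.stretch Grad.zero 1 := by
      simp only [Tree.sigma, Tree.stretchFrom_eq_leafSum]
    have e1' : (T.energy : ℝ) = (T.leafSum Grad.sSq Grad.zero 1 : ℝ) := by exact_mod_cast e1
    have e2' : (T.leafSum Grad.sSq Grad.zero 1 : ℝ) - (T.leafSum Grad.vortSq Grad.zero 1 : ℝ) / 2 = 0 := by
      exact_mod_cast e2
    have e3q : T.leafSum Grad.symCubeTrace Grad.zero 1 = -(3 / 4) * T.sigma := by linarith [e3]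
    have e3' : (T.leafSum Grad.symCubeTrace Grad.zero 1 : ℝ) = -(3 / 4) * (T.sigma : ℝ) := by
      rw [e3q]; push_cast; ring
    have e4' : (T.leafSum (Grad.quarticU T.vortSup) Grad.zero 1 : ℝ) ≤ 24 * M ^ 4 := by
      have h4 : ((T.leafSum (Grad.quarticU T.vortSup) Grad.zero 1 : ℚ) : ℝ) ≤ ((24 * T.vortSup ^ 2 : ℚ) : ℝ) := by
        exact_mod_cast e4
      push_cast at h4
      rw [hV] at h4
      calc (T.leafSum (Grad.quarticU T.vortSup) Grad.zero 1 : ℝ) ≤ 24 * (M ^ 2) ^ 2 := h4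
        _ = 24 * M ^ 4 := by ring
    have e5' : (T.leafSum (fun _ => (1 : ℚ)) Grad.zero 1 : ℝ) = 1 := by exact_mod_cast e5
    have e6' : (T.sigma : ℝ) = (T.leafSum Grad.stretch Grad.zero 1 : ℝ) := by exact_mod_cast e6
    have hcM : 0 ≤ c / M := div_nonneg hc hM.le
    have hlast : c / M * ((T.leafSum (Grad.quarticU T.vortSup) Grad.zero 1 : ℝ)
        - 24 * M ^ 4 * (T.leafSum (fun _ => (1 : ℚ)) Grad.zero 1 : ℝ)) ≤ 0 := by
      rw [e5', mul_one]
      have := mul_nonneg hcM (show (0 : ℝ) ≤ 24 * M ^ 4 - (T.leafSum (Grad.quarticU T.vortSup) Grad.zero 1 : ℝ)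
        by linarith)
      linarith
    rw [e2', e3', ← e1', ← e6'] at hsum
    linarith [hsum, hlast]

/-! ## THEOREM L-CAP (hand variant T4), kernel form modulo the pointwise node -/

/-- bank's T4 multiplier `a` (coefficient of the isometry relation). [ours; bookkeeping] -/
noncomputable def lcapA : ℝ := -562019 / 1000000

/-- bank's T4 multiplier `b` (coefficient of the Betchov relation). [ours; bookkeeping] -/
noncomputable def lcapB : ℝ := 2007 / 15625

/-- bank's T4 multiplier `c₄ ≥ 0` (coefficient of the quartic supersolution). [ours; bookkeeping] -/
noncomputable def lcapC : ℝ := 55539 / 40000000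

/-- bank's T4 cap `θ = 269427/250000 = 1.077708`. [ours; bookkeeping] -/
noncomputable def lcapTheta : ℝ := 269427 / 250000

end Laminate

/-- **The one remaining node of the T4 laminate cap** (typed obligation node, NOT asserted, NOT kernel):
bank's pointwise polynomial claim with the published T4 multipliers `θ = 269427/250000`,
`a = −562019/10⁶`, `b = 2007/15625`, `c₄ = 55539/(4·10⁷)` — `Laminate.LeafClaim θ a b c₄`.  Paper level:
`pub-nsfunc-bank/K1Q1-LAMINATE-CAP.md` §3 (T4) reduced to the 2-variable claim `Φ(m,q,s) ≤ 0` by the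
eigenvalue facts of §1, certified by two independent exact rational implementations (bank
`tools/lam/dual/certify_cap.py`, 104 376 boxes; census-1 A `exact/lamcap-A/lamcap_a.py` 0.1.2, 228 boxes +
discriminant argument), 0 contested.  search for candidate a priori estimates; no regularity claim. [ours; typed node] -/
@[conjecture] def LCapLeafClaim : Prop :=
  Laminate.LeafClaim Laminate.lcapTheta Laminate.lcapA Laminate.lcapB Laminate.lcapC

namespace Laminate

/-- **`LCapLeafClaim → C_lam ≤ 269427/250000 = 1.077708`** (THEOREM L-CAP, T4 variant, kernel modulo the
node). [ours; elementary] -/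
theorem laminateSupConst_le_of_lcapClaim (h : LCapLeafClaim) : laminateSupConst ≤ 269427 / 250000 := by
  have hc : (0 : ℝ) ≤ lcapC := by unfold lcapC; norm_num
  have hR : RatioBound lcapTheta := ratioBound_of_leafClaim h hc
  have := laminateSupConst_le_of_ratioBound hR
  unfold lcapTheta at this
  exact this

/-- **`LCapLeafClaim → LaminateDeficit`**: the T4 cap `1.077708 < 2/√3 = 1.1547…` already gives the
realization-free deficit of (ae). [ours; elementary] -/
theorem laminateDeficit_of_lcapClaim (h : LCapLeafClaim) : LaminateDeficit := by
  rw [laminateDeficit_iff]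
  have h1 := laminateSupConst_le_of_lcapClaim h
  have h3 : Real.sqrt 3 < 26 / 15 := by
    rw [Real.sqrt_lt' (by norm_num)]; norm_num
  have h3p : 0 < Real.sqrt 3 := Real.sqrt_pos.2 (by norm_num)
  have h2 : (269427 : ℝ) / 250000 < 2 / Real.sqrt 3 := by
    rw [lt_div_iff₀ h3p]; nlinarith
  linarith

end Laminate

end Summit.NavierStokesRegularity.FunctionalMining
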